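import Mathlib
import HarnessLib
import Summits.Ventures.LatticeQCDFlow.Exactness.SUNMultiStepLeapfrogFTHMCErgodic

/-!
# The engine's field-transformed MULTI-STEP `SU(N)` HMC (coordinates `sunCoordι`, kinetic term `−Σ tr P²`) is uniformly ergodic for short trajectories; trajectory-length form

HONEST FRAMING: exact (Metropolis-corrected) sampling algorithms for lattice gauge theory;
figures of merit are autocorrelation/cost numbers at stated couplings and volumes; no
continuum-physics claim.

Venture `LatticeQCDFlow` (cell pub-lqcd), topic `Exactness`; FANOUT row 14 (`eng-flowhmc`, family B:
field-transformed HMC reported through a certified member `F`; the `SU(N)` rung of rows 23–26 runs row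
9's engine coordinates).  NEW WORK of the cell over the tree (`SUNMultiStepLeapfrogFTHMCErgodic.lean`:
the reported `n`-step kernel in ANY coordinates is exact and uniformly ergodic for short trajectories;
row 9's `SUNMultiStepLeapfrogHMCEngine.lean`: the engine's coordinates `sunCoordι N`, kinetic term
`sunKinetic N`, `Z_T < ∞`, `trajLength_threshold_arith`, `measurable_halfKick_sun`); nothing here is
cited as a fact; no number.

* **`engine_sunLeapfrogFTHMCN_uniformlyErgodic`** / **`engine_sunLeapfrogFTHMCN_invariant_unique`** —
  for `N ≥ 1`, `n ≥ 1`, `ε > 0`, a measurable increment `|g| ≤ b` that is `K_g`-Lipschitz in the matrix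
  sup norm, a measurable `|S| ≤ s`, a measurable equivalence `F` with `HasJacobian Haar^⊗ F J`,
  `0 < j₁ ≤ J ≤ j₂` measurable, and `nε, (2n+1)b, K_g εn² ≤ s_N`: the reported chain converges to
  `Z_S⁻¹e^{−S}·Haar^{⊗links}` from EVERY initial law, and that law is its unique invariant law;
* **`engine_sunLeapfrogFTHMCN_uniformlyErgodic_of_trajLength`** — for a measurable force field `Φ` on
  the trivialized variables bounded by `Φ_max` per link and `K_Φ`-Lipschitz there is `τ₀ > 0`
  (coordinates, `Φ_max`, `K_Φ` only) such that EVERY `n ≥ 1`, `ε > 0` with `nε ≤ τ₀` give a convergent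
  reported chain with the half kick `−(ε/2)·Φ`; **`engine_sunLeapfrogFTHMCN_invariant_unique_of_trajLength`** —
  and its invariant probability law is unique.

NOT CLAIMED: anything beyond the threshold; any usable constant; which members / force fields qualify
(the member files of rows 14 / 23–26); OMF words; floating point; any number.
-/

noncomputable section

namespace Summit.Ventures.LatticeQCDFlow.Exactness

open MeasureTheory ProbabilityTheory ProbabilityTheory.Kernel Set Metric Function NormedSpace
open Literature.MathematicalPhysics.QuantumFieldTheory (haarProbability)
open scoped ENNReal Matrix Matrix.Norms.Operator NNReal

set_option backward.isDefEq.respectTransparency false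

/-! ## The engine's coordinates and kinetic term; trajectory-length form -/

section Engine

variable (N : ℕ) [NeZero N] {L : Type*} [Fintype L] {ε : ℝ} {nstep : ℕ}
  {g : (L → Matrix.specialUnitaryGroup (Fin N) ℂ) → L → SUNCoords N}
  {S : (L → Matrix.specialUnitaryGroup (Fin N) ℂ) → ℝ} {b Kg s : ℝ}
  {F : (L → Matrix.specialUnitaryGroup (Fin N) ℂ) ≃ᵐ (L → Matrix.specialUnitaryGroup (Fin N) ℂ)}
  {J : (L → Matrix.specialUnitaryGroup (Fin N) ℂ) → ℝ} {j₁ j₂ : ℝ}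

/-- **THE ENGINE'S FIELD-TRANSFORMED `n`-STEP HMC ON `SU(N)^links` IS UNIFORMLY ERGODIC FOR SHORT
TRAJECTORIES** (coordinates `sunCoordι`, kinetic term `−Σ tr P²`, refresh `Z⁻¹e^{−T}·addHaar^⊗`): for
`N ≥ 1`, `n ≥ 1`, `ε > 0`, a measurable increment `|g| ≤ b` that is `K_g`-Lipschitz in the matrix sup
norm, a measurable `|S| ≤ s`, a measurable equivalence `F` with `HasJacobian Haar^⊗ F J`,
`0 < j₁ ≤ J ≤ j₂` measurable, and `nε, (2n+1)b, K_g εn² ≤ s_N`: the reported chain converges to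
`Z_S⁻¹e^{−S}·Haar^⊗` from EVERY initial law, `|μ₀K̃ₙᵗ(A) − π_S(A)| ≤ (1 − δ)^{⌊t/(k+1)⌋}`. -/
theorem engine_sunLeapfrogFTHMCN_uniformlyErgodic (hε : 0 < ε) (hn : 1 ≤ nstep) (hg : Measurable g)
    (hb0 : 0 ≤ b) (hb : ∀ u l, ‖g u l‖ ≤ b) (hK0 : 0 ≤ Kg)
    (hK : ∀ U U', ‖g U - g U'‖ ≤ Kg * ‖coeConfig U - coeConfig U'‖) (hS : Measurable S) (hs : ∀ u, |S u| ≤ s)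
    (hj₁ : 0 < j₁) (hJ₁ : ∀ v, j₁ ≤ J v) (hJ₂ : ∀ v, J v ≤ j₂) (hJm : Measurable J)
    (hF : HasJacobian (Measure.pi fun _ : L => haarProbability (Matrix.specialUnitaryGroup (Fin N) ℂ)) F
      fun v => ENNReal.ofReal (J v))
    (h1 : nstep * ε ≤ sunShortTrajThreshold (sunCoordι N) (sunCoordι_injective N))
    (h2 : (2 * nstep + 1) * b ≤ sunShortTrajThreshold (sunCoordι N) (sunCoordι_injective N))
    (h3 : Kg * ε * (nstep : ℝ) ^ 2 ≤ sunShortTrajThreshold (sunCoordι N) (sunCoordι_injective N)) :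
    ∃ k : ℕ, ∃ δ : ℝ, 0 < δ ∧ δ ≤ 1 ∧ ∀ (μ₀ : Measure (L → Matrix.specialUnitaryGroup (Fin N) ℂ))
      [IsProbabilityMeasure μ₀] (t : ℕ) (A : Set (L → Matrix.specialUnitaryGroup (Fin N) ℂ)),
      |((fun m : Measure (L → Matrix.specialUnitaryGroup (Fin N) ℂ) =>
            m.bind (conjKernel (sunLeapfrogHMCN (sunCoordι N) (sunCoordι_skew N) ε (Measure.addHaar : Measure (SUNCoords N))
              (sunKinetic N) hg (fun v => S (F v) - Real.log (J v)) nstep) F))^[t] μ₀).real A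
          - (gibbsProbability (Measure.pi fun _ : L => haarProbability (Matrix.specialUnitaryGroup (Fin N) ℂ))
              (fun u => Real.exp (-S u))).real A| ≤ (1 - δ) ^ (t / (k + 1)) :=
  sunLeapfrogFTHMCN_uniformlyErgodic (sunCoordι N) (sunCoordι_skew N) Measure.addHaar (sunCoordι_injective N)
    (τ := fun R => Fintype.card L * ((N + 4 * Fintype.card (UpperPair N)) * R ^ 2))
    (sunCoordι_range N) hε hn (measurable_sunKinetic N) (sunKinetic_nonneg N)
    (sunKinetic_le_of_norm_le N) (sunMomentumWeight_sunKinetic_ne_top N Measure.addHaar) hg hb0 hb hK0 hK hS hs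
    hj₁ hJ₁ hJ₂ hJm hF h1 h2 h3

/-- **… and `Z_S⁻¹e^{−S}·Haar^{⊗links}` is the reported chain's ONLY invariant probability law.** -/
theorem engine_sunLeapfrogFTHMCN_invariant_unique (hε : 0 < ε) (hn : 1 ≤ nstep) (hg : Measurable g)
    (hb0 : 0 ≤ b) (hb : ∀ u l, ‖g u l‖ ≤ b) (hK0 : 0 ≤ Kg)
    (hK : ∀ U U', ‖g U - g U'‖ ≤ Kg * ‖coeConfig U - coeConfig U'‖) (hS : Measurable S) (hs : ∀ u, |S u| ≤ s)
    (hj₁ : 0 < j₁) (hJ₁ : ∀ v, j₁ ≤ J v) (hJ₂ : ∀ v, J v ≤ j₂) (hJm : Measurable J)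
    (hF : HasJacobian (Measure.pi fun _ : L => haarProbability (Matrix.specialUnitaryGroup (Fin N) ℂ)) F
      fun v => ENNReal.ofReal (J v))
    (h1 : nstep * ε ≤ sunShortTrajThreshold (sunCoordι N) (sunCoordι_injective N))
    (h2 : (2 * nstep + 1) * b ≤ sunShortTrajThreshold (sunCoordι N) (sunCoordι_injective N))
    (h3 : Kg * ε * (nstep : ℝ) ^ 2 ≤ sunShortTrajThreshold (sunCoordι N) (sunCoordι_injective N))
    {π' : Measure (L → Matrix.specialUnitaryGroup (Fin N) ℂ)} [IsProbabilityMeasure π']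
    (hπ' : Invariant (conjKernel (sunLeapfrogHMCN (sunCoordι N) (sunCoordι_skew N) ε (Measure.addHaar : Measure (SUNCoords N))
      (sunKinetic N) hg (fun v => S (F v) - Real.log (J v)) nstep) F) π') :
    π' = gibbsProbability (Measure.pi fun _ : L => haarProbability (Matrix.specialUnitaryGroup (Fin N) ℂ))
      (fun u => Real.exp (-S u)) :=
  sunLeapfrogFTHMCN_invariant_unique (sunCoordι N) (sunCoordι_skew N) Measure.addHaar (sunCoordι_injective N)
    (τ := fun R => Fintype.card L * ((N + 4 * Fintype.card (UpperPair N)) * R ^ 2))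
    (sunCoordι_range N) hε hn (measurable_sunKinetic N) (sunKinetic_nonneg N)
    (sunKinetic_le_of_norm_le N) (sunMomentumWeight_sunKinetic_ne_top N Measure.addHaar) hg hb0 hb hK0 hK hS hs
    hj₁ hJ₁ hJ₂ hJm hF h1 h2 h3 hπ'

variable {Φ : (L → Matrix.specialUnitaryGroup (Fin N) ℂ) → L → SUNCoords N} {Φmax KΦ : ℝ}

/-- **THE ENGINE'S FIELD-TRANSFORMED HMC IN TRAJECTORY-LENGTH FORM.**  For a measurable force field `Φ`
on the trivialized variables bounded by `Φ_max` per link and `K_Φ`-Lipschitz in the matrix sup norm, a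
measurable action `|S| ≤ s` and a member `F` with pinched measurable Jacobian: there is `τ₀ > 0`
(coordinates, `Φ_max`, `K_Φ` only) such that for EVERY `n ≥ 1`, `ε > 0` with `nε ≤ τ₀` the reported
`n`-step chain with the half kick `−(ε/2)·Φ` converges to `Z_S⁻¹e^{−S}·Haar^{⊗links}` from every initial
law geometrically in total variation. -/
theorem engine_sunLeapfrogFTHMCN_uniformlyErgodic_of_trajLength (hΦ : Measurable Φ) (hΦ0 : 0 ≤ Φmax)
    (hΦb : ∀ U l, ‖Φ U l‖ ≤ Φmax) (hKΦ0 : 0 ≤ KΦ) (hΦK : ∀ U U', ‖Φ U - Φ U'‖ ≤ KΦ * ‖coeConfig U - coeConfig U'‖)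
    (hS : Measurable S) (hs : ∀ u, |S u| ≤ s)
    (hj₁ : 0 < j₁) (hJ₁ : ∀ v, j₁ ≤ J v) (hJ₂ : ∀ v, J v ≤ j₂) (hJm : Measurable J)
    (hF : HasJacobian (Measure.pi fun _ : L => haarProbability (Matrix.specialUnitaryGroup (Fin N) ℂ)) F
      fun v => ENNReal.ofReal (J v)) :
    ∃ τ₀ : ℝ, 0 < τ₀ ∧ ∀ (nstep : ℕ) (ε : ℝ) (hn : 1 ≤ nstep) (hε : 0 < ε), nstep * ε ≤ τ₀ →
      ∃ k : ℕ, ∃ δ : ℝ, 0 < δ ∧ δ ≤ 1 ∧ ∀ (μ₀ : Measure (L → Matrix.specialUnitaryGroup (Fin N) ℂ))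
        [IsProbabilityMeasure μ₀] (t : ℕ) (A : Set (L → Matrix.specialUnitaryGroup (Fin N) ℂ)),
        |((fun m : Measure (L → Matrix.specialUnitaryGroup (Fin N) ℂ) =>
              m.bind (conjKernel (sunLeapfrogHMCN (sunCoordι N) (sunCoordι_skew N) ε (Measure.addHaar : Measure (SUNCoords N))
                (sunKinetic N) (measurable_halfKick_sun N hΦ ε) (fun v => S (F v) - Real.log (J v)) nstep) F))^[t] μ₀).real A
            - (gibbsProbability (Measure.pi fun _ : L => haarProbability (Matrix.specialUnitaryGroup (Fin N) ℂ))
                (fun u => Real.exp (-S u))).real A| ≤ (1 - δ) ^ (t / (k + 1)) := by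
  set s₀ := sunShortTrajThreshold (sunCoordι N) (sunCoordι_injective N) with hs₀
  have hs₀0 : 0 < s₀ := sunShortTrajThreshold_pos _ _
  refine ⟨min s₀ (min (s₀ / (3 * Φmax + 1)) (Real.sqrt (s₀ / (KΦ + 1)))),
    lt_min hs₀0 (lt_min (by positivity) (Real.sqrt_pos.2 (by positivity))), fun nstep ε hn hε hτ => ?_⟩
  obtain ⟨h1, h2, h3⟩ := trajLength_threshold_arith hs₀0 hΦ0 hKΦ0 hn hε rfl hτ
  refine engine_sunLeapfrogFTHMCN_uniformlyErgodic N hε hn (measurable_halfKick_sun N hΦ ε) (b := ε / 2 * Φmax)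
    (Kg := ε / 2 * KΦ) (by positivity) (fun U l => ?_) (by positivity) (fun U U' => ?_) hS hs hj₁ hJ₁ hJ₂ hJm hF h1 h2 h3
  · rw [Pi.smul_apply, norm_smul, Real.norm_eq_abs, abs_neg, abs_of_pos (by positivity)]
    exact mul_le_mul_of_nonneg_left (hΦb U l) (by positivity)
  · have hsub : (-(ε / 2)) • Φ U - (-(ε / 2)) • Φ U' = (-(ε / 2)) • (Φ U - Φ U') := by
      funext l; simp only [Pi.sub_apply, Pi.smul_apply, smul_sub]
    rw [hsub, norm_smul, Real.norm_eq_abs, abs_neg, abs_of_pos (by positivity), mul_assoc]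
    exact mul_le_mul_of_nonneg_left (hΦK U U') (by positivity)

/-- **… and, below a trajectory-length threshold, `Z_S⁻¹e^{−S}·Haar^{⊗links}` is the UNIQUE invariant
probability law** of the reported `n`-step chain with the half kick `−(ε/2)·Φ` (same hypotheses). -/
theorem engine_sunLeapfrogFTHMCN_invariant_unique_of_trajLength (hΦ : Measurable Φ) (hΦ0 : 0 ≤ Φmax)
    (hΦb : ∀ U l, ‖Φ U l‖ ≤ Φmax) (hKΦ0 : 0 ≤ KΦ) (hΦK : ∀ U U', ‖Φ U - Φ U'‖ ≤ KΦ * ‖coeConfig U - coeConfig U'‖)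
    (hS : Measurable S) (hs : ∀ u, |S u| ≤ s)
    (hj₁ : 0 < j₁) (hJ₁ : ∀ v, j₁ ≤ J v) (hJ₂ : ∀ v, J v ≤ j₂) (hJm : Measurable J)
    (hF : HasJacobian (Measure.pi fun _ : L => haarProbability (Matrix.specialUnitaryGroup (Fin N) ℂ)) F
      fun v => ENNReal.ofReal (J v)) :
    ∃ τ₀ : ℝ, 0 < τ₀ ∧ ∀ (nstep : ℕ) (ε : ℝ) (_hn : 1 ≤ nstep) (_hε : 0 < ε), nstep * ε ≤ τ₀ →
      ∀ (π' : Measure (L → Matrix.specialUnitaryGroup (Fin N) ℂ)) [IsProbabilityMeasure π'],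
        Invariant (conjKernel (sunLeapfrogHMCN (sunCoordι N) (sunCoordι_skew N) ε (Measure.addHaar : Measure (SUNCoords N))
          (sunKinetic N) (measurable_halfKick_sun N hΦ ε) (fun v => S (F v) - Real.log (J v)) nstep) F) π' →
        π' = gibbsProbability (Measure.pi fun _ : L => haarProbability (Matrix.specialUnitaryGroup (Fin N) ℂ))
          (fun u => Real.exp (-S u)) := by
  set s₀ := sunShortTrajThreshold (sunCoordι N) (sunCoordι_injective N) with hs₀
  have hs₀0 : 0 < s₀ := sunShortTrajThreshold_pos _ _
  refine ⟨min s₀ (min (s₀ / (3 * Φmax + 1)) (Real.sqrt (s₀ / (KΦ + 1)))),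
    lt_min hs₀0 (lt_min (by positivity) (Real.sqrt_pos.2 (by positivity))), fun nstep ε hn hε hτ π' _ hπ' => ?_⟩
  obtain ⟨h1, h2, h3⟩ := trajLength_threshold_arith hs₀0 hΦ0 hKΦ0 hn hε rfl hτ
  refine engine_sunLeapfrogFTHMCN_invariant_unique N hε hn (measurable_halfKick_sun N hΦ ε) (b := ε / 2 * Φmax)
    (Kg := ε / 2 * KΦ) (by positivity) (fun U l => ?_) (by positivity) (fun U U' => ?_) hS hs hj₁ hJ₁ hJ₂ hJm hF h1 h2 h3 hπ'
  · rw [Pi.smul_apply, norm_smul, Real.norm_eq_abs, abs_neg, abs_of_pos (by positivity)]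
    exact mul_le_mul_of_nonneg_left (hΦb U l) (by positivity)
  · have hsub : (-(ε / 2)) • Φ U - (-(ε / 2)) • Φ U' = (-(ε / 2)) • (Φ U - Φ U') := by
      funext l; simp only [Pi.sub_apply, Pi.smul_apply, smul_sub]
    rw [hsub, norm_smul, Real.norm_eq_abs, abs_neg, abs_of_pos (by positivity), mul_assoc]
    exact mul_le_mul_of_nonneg_left (hΦK U U') (by positivity)

end Engine


end Summit.Ventures.LatticeQCDFlow.Exactness
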